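import Mathlib
import Summits.PneNP.PneNP.Theorems.ClusUniversalCertificateCoordBookBlkT

/-!
# Route ClusUniversalCertificate, crux `UniversalCertAll` — path `coord`: bookkeeping for q-FOLD (fractional) layer families

Support file for `stmt-PneNP-19683` (cell pnp-ideate, route `ClusUniversalCertificate`, rung F-N1; path `coord` of pnp-ideate-p1, skeleton v12
sha16 3864e21c and p1 g7's ROUND-7 §3 «the fractional relaxation (v13 plan)»; objects of record `…CoordDefs.lean` p516754 / `…CoordBlkDefs.lean`
p519312 / `…CoordBookBlkT.lean` p524686, namespace `…Theorems.ClusCoord`).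

Every bookkeeping identity of the coordinate step (`stub_cBook`) and of the block step with translate credit (`cBookBlkT`) is LINEAR in the
incidence vector of the family, so a FRACTIONAL layer family proves the step as well.  In integers: a **q-fold family** (`q ≥ 1`) covers each
fibre `q` times its multiplicity (`IsCLayerFamilyQ`, `IsBLayerFamilyQ`), the layer inequalities are multiplied by `q` on the `Y`-side
(`CLayerIneqQ`, `BLayerIneqTQ`), and the members' certificates summed over the family give `q` times the certificate of `Y`; dividing by `q > 0`
yields `UCMix M n blk Y` (`cBookQ`, `cBookBlkTQ`).  For `q = 1` these are `stub_cBook` and `cBookBlkT`.  Generic engine: double counting with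
multiplicity `q` (`list_sum_card_filter_eq_mul`).
FRONTIER rung F-N1 (a combinatorial certificate about affine flats in `𝔽₂^M`); bookkeeping only — the conjecture and the crux are OPEN; nothing
here bears on P vs NP.
-/

set_option linter.dupNamespace false -- `Summit.PneNP.PneNP.…`: summit = sub-problem name (D-0017 single-conjunct layout)

namespace Summit.PneNP.PneNP.Theorems.ClusCoordBookQ

open Finset
open Summit.PneNP.PneNP.Theorems.ClusCoord (acodim dsum bsize zcount wcount UCMix kemb)
open Summit.PneNP.PneNP.Theorems.ClusCoordBook (list_sum_map_finset_sum list_sum_indicator list_sum_map_le list_sum_map_sub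
  list_sum_map_mul blockZero_removeNth_iff_of_ne blockZero_removeNth_iff_self bsize_self_sub_one pow_bsize_eq sum_bsize_sub_one)
open Summit.PneNP.PneNP.Theorems.ClusCoordBookBlk (bsize_kemb_self bsize_kemb_of_ne sum_bsize_sub_one_kemb blockZero_kemb_iff_of_ne)
open Summit.PneNP.PneNP.Theorems.ClusCoordBookBlkT (card_image_add dsum_le_dsum_image_add zcount_kemb_self)

/-! ## Double counting with multiplicity `q` -/

/-- **Double counting, q-fold.** If every point `x` lies in exactly `q` times as many members of `L` as `Y` has points over `x`, then
`Σ_{S ∈ L} #{x ∈ S : P x} = q · #{y ∈ Y : P (π y)}`. -/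
theorem list_sum_card_filter_eq_mul {α β : Type*} [Fintype β] [DecidableEq β] (π : α → β) (Y : Finset α) (q : ℕ)
    (L : List (Finset β)) (hL : ∀ x : β, (L.filter fun S => x ∈ S).length = q * (Y.filter fun y => π y = x).card)
    (P : β → Prop) [DecidablePred P] :
    (L.map fun S => ((S.filter P).card : ℤ)).sum = (q : ℤ) * ((Y.filter fun y => P (π y)).card : ℤ) := by
  have hS : ∀ S : Finset β, ((S.filter P).card : ℤ) = ∑ x ∈ univ.filter P, (if x ∈ S then (1 : ℤ) else 0) := by
    intro S
    rw [Finset.sum_ite_mem, Finset.card_eq_sum_ones, Nat.cast_sum]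
    simp only [Nat.cast_one]
    congr 1
    ext x
    simp [and_comm]
  have hL' : ∀ x : β, ((L.filter fun S => x ∈ S).length : ℤ) = (q : ℤ) * ((Y.filter fun y => π y = x).card : ℤ) :=
    fun x => by rw [hL x]; push_cast; ring
  simp_rw [hS]
  rw [list_sum_map_finset_sum]
  simp_rw [list_sum_indicator, hL']
  rw [← Finset.mul_sum]
  congr 1
  rw [Finset.card_eq_sum_card_fiberwise (f := π) (s := Y.filter fun y => P (π y)) (t := univ.filter P)
    (fun y hy => Finset.mem_filter.2 ⟨Finset.mem_univ _, (Finset.mem_filter.1 hy).2⟩)]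
  push_cast
  refine Finset.sum_congr rfl fun x hx => ?_
  have hPx : P x := (Finset.mem_filter.1 hx).2
  congr 2
  ext y
  simp only [Finset.mem_filter]
  constructor
  · rintro ⟨hy, hyx⟩; exact ⟨⟨hy, hyx ▸ hPx⟩, hyx⟩
  · rintro ⟨⟨hy, -⟩, hyx⟩; exact ⟨hy, hyx⟩

end Summit.PneNP.PneNP.Theorems.ClusCoordBookQ

namespace Summit.PneNP.PneNP.Theorems.ClusCoord

open Finset
open Summit.PneNP.PneNP.Theorems.ClusCoordBook (list_sum_map_finset_sum list_sum_map_le list_sum_map_sub list_sum_map_mul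
  blockZero_removeNth_iff_of_ne blockZero_removeNth_iff_self bsize_self_sub_one pow_bsize_eq sum_bsize_sub_one)
open Summit.PneNP.PneNP.Theorems.ClusCoordBookBlk (bsize_kemb_self bsize_kemb_of_ne sum_bsize_sub_one_kemb blockZero_kemb_iff_of_ne)
open Summit.PneNP.PneNP.Theorems.ClusCoordBookBlkT (card_image_add dsum_le_dsum_image_add zcount_kemb_self)
open Summit.PneNP.PneNP.Theorems.ClusCoordBookQ (list_sum_card_filter_eq_mul)

/-! ## The q-fold objects -/

/-- `L` is a q-FOLD COORDINATE LAYER FAMILY for `(Y, i)`: each `x` lies in `q` times as many members as `Y` has points over `x`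
under deletion of coordinate `i`. -/
def IsCLayerFamilyQ {M : ℕ} (Y : Finset (Fin (M + 1) → ZMod 2)) (i : Fin (M + 1)) (q : ℕ)
    (L : List (Finset (Fin M → ZMod 2))) : Prop :=
  ∀ x : Fin M → ZMod 2, (L.filter fun S => x ∈ S).length = q * (Y.filter fun y => Fin.removeNth i y = x).card

/-- The q-fold COORDINATE LAYER INEQUALITY: `q·D(Y) ≤ Σ_{S∈L} D(S) + q·(|Y| + 2^{bsize k − 1}(Z_k(Y) − W_i(Y)))`, `k = blk i`. -/
def CLayerIneqQ (M n : ℕ) (blk : Fin (M + 1) → Fin n) (Y : Finset (Fin (M + 1) → ZMod 2)) (i : Fin (M + 1)) (q : ℕ)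
    (L : List (Finset (Fin M → ZMod 2))) : Prop :=
  (q : ℤ) * dsum (M + 1) Y ≤ (L.map (dsum M)).sum +
    (q : ℤ) * ((Y.card : ℤ) + (2 : ℤ) ^ (bsize blk (blk i) - 1) * ((zcount blk (blk i) Y : ℤ) - (wcount blk i Y : ℤ)))

/-- `L` is a q-FOLD BLOCK LAYER FAMILY for `(Y, k)`: each `x` lies in `q` times as many members as `Y` has points over `x` under deletion
of block `k`. -/
def IsBLayerFamilyQ {M n : ℕ} (blk : Fin M → Fin n) (Y : Finset (Fin M → ZMod 2)) (k : Fin n) (M' : ℕ)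
    (h : (univ.filter fun i => blk i ≠ k).card = M') (q : ℕ) (L : List (Finset (Fin M' → ZMod 2))) : Prop :=
  ∀ x : Fin M' → ZMod 2, (L.filter fun S => x ∈ S).length = q * (Y.filter fun y => (fun j => y (kemb blk k M' h j)) = x).card

/-- The q-fold BLOCK LAYER INEQUALITY WITH TRANSLATE CREDIT for members with chosen translates `(S, t_S)`:
`q·D(Y) ≤ Σ_S D(S) + q·((bsize k − 1)|Y| + 2^{bsize k} Z_k(Y)) + Σ_{j ≠ k} 2^{bsize j}·(q·Z_j(Y) − Σ_S Z_j(S + t_S))`. -/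
def BLayerIneqTQ (M n : ℕ) (blk : Fin M → Fin n) (Y : Finset (Fin M → ZMod 2)) (k : Fin n) (M' : ℕ)
    (h : (univ.filter fun i => blk i ≠ k).card = M') (q : ℕ) (L : List (Finset (Fin M' → ZMod 2) × (Fin M' → ZMod 2))) : Prop :=
  (q : ℤ) * dsum M Y ≤ (L.map fun p => dsum M' p.1).sum +
    (q : ℤ) * (((bsize blk k : ℤ) - 1) * (Y.card : ℤ) + (2 : ℤ) ^ (bsize blk k) * (zcount blk k Y : ℤ)) +
    ∑ j ∈ univ.erase k, (2 : ℤ) ^ (bsize blk j) *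
      ((q : ℤ) * (zcount blk j Y : ℤ) - (L.map fun p => (zcount (blk ∘ kemb blk k M' h) j (p.1.image fun x => x + p.2) : ℤ)).sum)

/-! ## The coordinate step, q-fold -/

/-- **q-fold coordinate bookkeeping** (support theorem for stmt-PneNP-19683, path `coord`): a q-fold coordinate layer family with the q-fold
coordinate layer inequality transfers the members' mixed certificates to `Y` (for `q = 1`: `stub_cBook`). -/
theorem cBookQ : ∀ M n : ℕ, ∀ blk : Fin (M + 1) → Fin n, ∀ Y : Finset (Fin (M + 1) → ZMod 2), ∀ i : Fin (M + 1), ∀ q : ℕ,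
    ∀ L : List (Finset (Fin M → ZMod 2)), 0 < q → IsCLayerFamilyQ Y i q L → CLayerIneqQ M n blk Y i q L →
      (∀ S ∈ L, UCMix M n (blk ∘ Fin.succAbove i) S) → UCMix (M + 1) n blk Y := by
  intro M n blk Y i q L hq hfam hineq hmem
  set blk' : Fin M → Fin n := blk ∘ Fin.succAbove i with hblk'
  set B' : ℤ := ∑ j : Fin n, ((bsize blk' j : ℤ) - 1) with hB'
  -- the counting identities, q-fold
  have hcard : (L.map fun S => (S.card : ℤ)).sum = (q : ℤ) * (Y.card : ℤ) := by
    have h := list_sum_card_filter_eq_mul (fun y => Fin.removeNth i y) Y q L hfam (fun _ => True)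
    simp only [Finset.filter_true_of_mem (fun _ _ => trivial)] at h
    exact h
  have hz : ∀ j : Fin n, (L.map fun S => (zcount blk' j S : ℤ)).sum =
      (q : ℤ) * ((zcount blk j Y : ℤ) + (if blk i = j then (wcount blk i Y : ℤ) else 0)) := by
    intro j
    unfold zcount
    rw [list_sum_card_filter_eq_mul (fun y => Fin.removeNth i y) Y q L hfam]
    by_cases hj : blk i = j
    · subst hj
      rw [if_pos rfl]
      unfold wcount
      rw [Finset.filter_congr fun y (_ : y ∈ Y) => blockZero_removeNth_iff_self blk i y, Finset.filter_or,
        Finset.card_union_of_disjoint, Nat.cast_add]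
      apply Finset.disjoint_filter.2
      intro y _ h0 h1
      have := h0 i rfl
      rw [h1.1] at this
      exact one_ne_zero this
    · rw [if_neg hj, add_zero]
      congr 3
      exact Finset.filter_congr fun y _ => blockZero_removeNth_iff_of_ne blk i j hj y
  -- the members' certificates
  have hmem' : ∀ S ∈ L, dsum M S - B' * (S.card : ℤ) ≤
      ∑ j : Fin n, (2 : ℤ) ^ (bsize blk' j) * (zcount blk' j S : ℤ) := by
    intro S hS
    have h := hmem S hS
    unfold UCMix at h
    unfold dsum
    rw [Finset.sum_sub_distrib, Finset.sum_const, nsmul_eq_mul] at h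
    linarith
  have hsum : (L.map (dsum M)).sum - B' * ((q : ℤ) * (Y.card : ℤ)) ≤
      (q : ℤ) * (∑ j : Fin n, (2 : ℤ) ^ (bsize blk' j) * ((zcount blk j Y : ℤ) + (if blk i = j then (wcount blk i Y : ℤ) else 0))) := by
    have h1 := list_sum_map_le L _ _ hmem'
    rw [list_sum_map_sub, list_sum_map_mul, hcard, list_sum_map_finset_sum] at h1
    refine h1.trans (le_of_eq ?_)
    rw [Finset.mul_sum]
    refine Finset.sum_congr rfl fun j _ => ?_
    rw [list_sum_map_mul, hz j]
    ring
  -- the q-fold coordinate layer inequality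
  unfold CLayerIneqQ at hineq
  rw [bsize_self_sub_one blk i] at hineq
  -- the goal times `q`
  unfold UCMix
  rw [Finset.sum_sub_distrib, Finset.sum_const, nsmul_eq_mul, sum_bsize_sub_one blk i]
  change dsum (M + 1) Y - _ ≤ _
  have hrhs : ∑ j : Fin n, (2 : ℤ) ^ (bsize blk j) * (zcount blk j Y : ℤ) =
      ∑ j : Fin n, (2 : ℤ) ^ (bsize blk' j) * (zcount blk j Y : ℤ) +
        (2 : ℤ) ^ (bsize blk' (blk i)) * (zcount blk (blk i) Y : ℤ) := by
    have h : ∀ j : Fin n, (2 : ℤ) ^ (bsize blk j) * (zcount blk j Y : ℤ) =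
        (2 : ℤ) ^ (bsize blk' j) * (zcount blk j Y : ℤ) +
          (if blk i = j then (2 : ℤ) ^ (bsize blk' j) * (zcount blk j Y : ℤ) else 0) := by
      intro j
      rw [pow_bsize_eq blk i j]
      by_cases hj : blk i = j
      · rw [if_pos hj, if_pos hj]; ring
      · rw [if_neg hj, if_neg hj]; ring
    simp_rw [h]
    rw [Finset.sum_add_distrib, Finset.sum_ite_eq]
    simp
  have hsplit : ∑ j : Fin n, (2 : ℤ) ^ (bsize blk' j) * ((zcount blk j Y : ℤ) + (if blk i = j then (wcount blk i Y : ℤ) else 0)) =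
      ∑ j : Fin n, (2 : ℤ) ^ (bsize blk' j) * (zcount blk j Y : ℤ) +
        (2 : ℤ) ^ (bsize blk' (blk i)) * (wcount blk i Y : ℤ) := by
    have h : ∀ j : Fin n, (2 : ℤ) ^ (bsize blk' j) * ((zcount blk j Y : ℤ) + (if blk i = j then (wcount blk i Y : ℤ) else 0)) =
        (2 : ℤ) ^ (bsize blk' j) * (zcount blk j Y : ℤ) +
          (if blk i = j then (2 : ℤ) ^ (bsize blk' j) * (wcount blk i Y : ℤ) else 0) := by
      intro j
      by_cases hj : blk i = j
      · rw [if_pos hj, if_pos hj]; ring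
      · rw [if_neg hj, if_neg hj]; ring
    simp_rw [h]
    rw [Finset.sum_add_distrib, Finset.sum_ite_eq]
    simp
  rw [hsplit] at hsum
  rw [hrhs]
  -- `q · (goal inequality)` holds; divide by `q > 0`
  have hq' : (0 : ℤ) < (q : ℤ) := by exact_mod_cast hq
  have key : (q : ℤ) * (dsum (M + 1) Y - (Y.card : ℤ) * (B' + 1)) ≤
      (q : ℤ) * (∑ j : Fin n, (2 : ℤ) ^ (bsize blk' j) * (zcount blk j Y : ℤ) +
        (2 : ℤ) ^ (bsize blk' (blk i)) * (zcount blk (blk i) Y : ℤ)) := by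
    nlinarith
  rw [← hB']
  exact le_of_mul_le_mul_left key hq'

/-! ## The block step with translate credit, q-fold -/

/-- **q-fold block bookkeeping with translate credit** (support theorem for stmt-PneNP-19683, path `coord`): a q-fold block layer family
whose members, translated by their chosen `t_S`, satisfy the mixed certificate one block down, together with the q-fold translate-credited
block layer inequality, gives the mixed certificate of `Y` (for `q = 1`: `cBookBlkT`). -/
theorem cBookBlkTQ : ∀ M M' n : ℕ, ∀ blk : Fin M → Fin n, ∀ Y : Finset (Fin M → ZMod 2), ∀ k : Fin n,
    ∀ h : (univ.filter fun i => blk i ≠ k).card = M', ∀ q : ℕ, ∀ L : List (Finset (Fin M' → ZMod 2) × (Fin M' → ZMod 2)),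
    0 < q → IsBLayerFamilyQ blk Y k M' h q (L.map Prod.fst) → BLayerIneqTQ M n blk Y k M' h q L →
    (∀ p ∈ L, UCMix M' n (blk ∘ kemb blk k M' h) (p.1.image fun x => x + p.2)) → UCMix M n blk Y := by
  intro M M' n blk Y k h q L hq hfam hineq hmem
  set blk' : Fin M' → Fin n := blk ∘ kemb blk k M' h with hblk'
  set B' : ℤ := ∑ j : Fin n, ((bsize blk' j : ℤ) - 1) with hB'
  -- the members' certificates at their translates
  have hmem' : ∀ p ∈ L, dsum M' p.1 - B' * (p.1.card : ℤ) ≤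
      ∑ j : Fin n, (2 : ℤ) ^ (bsize blk' j) * (zcount blk' j (p.1.image fun x => x + p.2) : ℤ) := by
    intro p hp
    have h1 := hmem p hp
    unfold UCMix at h1
    rw [Finset.sum_sub_distrib, Finset.sum_const, nsmul_eq_mul, card_image_add, ← hB'] at h1
    change dsum M' (p.1.image fun x => x + p.2) - (p.1.card : ℤ) * B' ≤ _ at h1
    have h2 := dsum_le_dsum_image_add p.1 p.2
    linarith
  -- `Σ_S |S| = q·|Y|`
  have hcard : (L.map fun p => (p.1.card : ℤ)).sum = (q : ℤ) * (Y.card : ℤ) := by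
    have h' := list_sum_card_filter_eq_mul (fun y : Fin M → ZMod 2 => fun l' => y (kemb blk k M' h l')) Y q (L.map Prod.fst) hfam
      (fun _ => True)
    simp only [Finset.filter_true_of_mem (fun _ _ => trivial), List.map_map] at h'
    exact h'
  -- summed over the family
  have hsum : (L.map fun p => dsum M' p.1).sum - B' * ((q : ℤ) * (Y.card : ℤ)) ≤
      ∑ j : Fin n, (2 : ℤ) ^ (bsize blk' j) *
        (L.map fun p => (zcount blk' j (p.1.image fun x => x + p.2) : ℤ)).sum := by
    have h1 := list_sum_map_le L _ _ hmem'
    rw [list_sum_map_sub, list_sum_map_mul, hcard, list_sum_map_finset_sum] at h1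
    refine h1.trans (le_of_eq (Finset.sum_congr rfl fun j _ => ?_))
    rw [list_sum_map_mul]
  -- block `k`: empty one block down (weight `2^0`, `Z_k(S + t) = |S|`)
  have hrhs : ∑ j : Fin n, (2 : ℤ) ^ (bsize blk' j) *
        (L.map fun p => (zcount blk' j (p.1.image fun x => x + p.2) : ℤ)).sum =
      (q : ℤ) * (Y.card : ℤ) + ∑ j ∈ univ.erase k, (2 : ℤ) ^ (bsize blk j) *
        (L.map fun p => (zcount blk' j (p.1.image fun x => x + p.2) : ℤ)).sum := by
    rw [← Finset.add_sum_erase univ _ (Finset.mem_univ k)]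
    rw [hblk', bsize_kemb_self blk k h, pow_zero, one_mul]
    congr 1
    · rw [← hcard]
      congr 1
      refine List.map_congr_left fun p _ => ?_
      rw [zcount_kemb_self blk k h, card_image_add]
    · refine Finset.sum_congr rfl fun j hj => ?_
      rw [bsize_kemb_of_ne blk k h j (Finset.ne_of_mem_erase hj)]
  rw [hrhs] at hsum
  -- the q-fold inequality
  unfold BLayerIneqTQ at hineq
  rw [← hblk'] at hineq
  have hsplit : ∑ j ∈ univ.erase k, (2 : ℤ) ^ (bsize blk j) *
        ((q : ℤ) * (zcount blk j Y : ℤ) - (L.map fun p => (zcount blk' j (p.1.image fun x => x + p.2) : ℤ)).sum) =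
      (q : ℤ) * ∑ j ∈ univ.erase k, (2 : ℤ) ^ (bsize blk j) * (zcount blk j Y : ℤ) -
        ∑ j ∈ univ.erase k, (2 : ℤ) ^ (bsize blk j) *
          (L.map fun p => (zcount blk' j (p.1.image fun x => x + p.2) : ℤ)).sum := by
    rw [Finset.mul_sum, ← Finset.sum_sub_distrib]
    refine Finset.sum_congr rfl fun j _ => ?_
    ring
  rw [hsplit] at hineq
  -- the goal times `q`, then divide
  unfold UCMix
  rw [Finset.sum_sub_distrib, Finset.sum_const, nsmul_eq_mul, sum_bsize_sub_one_kemb blk k h,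
    ← Finset.add_sum_erase univ (fun j => (2 : ℤ) ^ (bsize blk j) * (zcount blk j Y : ℤ)) (Finset.mem_univ k)]
  change dsum M Y - _ ≤ _
  rw [← hblk', ← hB']
  have hq' : (0 : ℤ) < (q : ℤ) := by exact_mod_cast hq
  have key : (q : ℤ) * (dsum M Y - (Y.card : ℤ) * (B' + (bsize blk k : ℤ))) ≤
      (q : ℤ) * ((2 : ℤ) ^ (bsize blk k) * (zcount blk k Y : ℤ) +
        ∑ j ∈ univ.erase k, (2 : ℤ) ^ (bsize blk j) * (zcount blk j Y : ℤ)) := by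
    nlinarith
  exact le_of_mul_le_mul_left key hq'

/-! ## `q = 1`: the plain statements -/

/-- A `1`-fold coordinate layer family is a coordinate layer family. -/
theorem isCLayerFamilyQ_one_iff {M : ℕ} (Y : Finset (Fin (M + 1) → ZMod 2)) (i : Fin (M + 1))
    (L : List (Finset (Fin M → ZMod 2))) : IsCLayerFamilyQ Y i 1 L ↔ IsCLayerFamily Y i L := by
  unfold IsCLayerFamilyQ IsCLayerFamily
  simp only [one_mul]

/-- The `1`-fold coordinate layer inequality is the coordinate layer inequality. -/
theorem cLayerIneqQ_one_iff {M n : ℕ} (blk : Fin (M + 1) → Fin n) (Y : Finset (Fin (M + 1) → ZMod 2)) (i : Fin (M + 1))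
    (L : List (Finset (Fin M → ZMod 2))) : CLayerIneqQ M n blk Y i 1 L ↔ CLayerIneq M n blk Y i L := by
  unfold CLayerIneqQ CLayerIneq
  push_cast
  simp only [one_mul]
  constructor <;> intro h <;> linarith

/-- A `1`-fold block layer family is a block layer family. -/
theorem isBLayerFamilyQ_one_iff {M n M' : ℕ} (blk : Fin M → Fin n) (Y : Finset (Fin M → ZMod 2)) (k : Fin n)
    (h : (univ.filter fun i => blk i ≠ k).card = M') (L : List (Finset (Fin M' → ZMod 2))) :
    IsBLayerFamilyQ blk Y k M' h 1 L ↔ IsBLayerFamily blk Y k M' h L := by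
  unfold IsBLayerFamilyQ IsBLayerFamily
  simp only [one_mul]

/-- The `1`-fold translate-credited block layer inequality is `BLayerIneqT`. -/
theorem bLayerIneqTQ_one_iff {M n M' : ℕ} (blk : Fin M → Fin n) (Y : Finset (Fin M → ZMod 2)) (k : Fin n)
    (h : (univ.filter fun i => blk i ≠ k).card = M') (L : List (Finset (Fin M' → ZMod 2) × (Fin M' → ZMod 2))) :
    BLayerIneqTQ M n blk Y k M' h 1 L ↔ BLayerIneqT M n blk Y k M' h L := by
  unfold BLayerIneqTQ BLayerIneqT
  push_cast
  simp only [one_mul]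
  constructor <;> intro h' <;> linarith

/-- Sanity check: `cBookBlkT` is the case `q = 1` of `cBookBlkTQ`. -/
example {M M' n : ℕ} (blk : Fin M → Fin n) (Y : Finset (Fin M → ZMod 2)) (k : Fin n)
    (h : (univ.filter fun i => blk i ≠ k).card = M') (L : List (Finset (Fin M' → ZMod 2) × (Fin M' → ZMod 2)))
    (hfam : IsBLayerFamily blk Y k M' h (L.map Prod.fst)) (hineq : BLayerIneqT M n blk Y k M' h L)
    (hmem : ∀ p ∈ L, UCMix M' n (blk ∘ kemb blk k M' h) (p.1.image fun x => x + p.2)) : UCMix M n blk Y :=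
  cBookBlkTQ M M' n blk Y k h 1 L one_pos ((isBLayerFamilyQ_one_iff blk Y k h _).mpr hfam)
    ((bLayerIneqTQ_one_iff blk Y k h L).mpr hineq) hmem

end Summit.PneNP.PneNP.Theorems.ClusCoord
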